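import Literature.Computability.AlgebraicComplexity.CombinationLossProgramLevelTwo
import HarnessLib

/-!
# The combination-loss laser program at level `ℓ* = 3` (fourth power of `CW_q`): typed statement
(Dupont–Eisenberger–Kozlovskii–Mehrabian–Ruiz–See–Zhou–Alman–Vassilevska Williams–Balog 2026, §2,
program (11) and Theorem 1 = Alman–Duan–Vassilevska Williams–Xu–Xu–Zhou 2025, §7)

Topic `Literature/Computability/AlgebraicComplexity`.  Companion of
`CombinationLossProgramLevelTwo.lean`, which TYPES program (11) of arXiv:2608.16884v1 §2 at `ℓ* = 2`.
This file types the next instance, `ℓ* = 3` — the analysis of `CW_q^{⊗4}`, the program whose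
numerical solution at `q = 5` is the refereed record `ω < 2.371339` of Alman et al. (SODA 2025,
Table 1; parameters at osf.io/mw5ak) — verbatim from the note's §2 with `ℓ* = 3` substituted.  The
tree now has three kinds of non-root nodes (§2.1): the root's children `G[s, r]` (`s ∈ S₃`, 45 shapes;
a LEAF when `s` is a zero-shape, a level-3 POSITIVE NODE `T` when `s` is positive), and the children
`T[u, r′]` (`u ∈ Split(s) ⊆ S₂`, `r′ ∈ [6]`) of the positive nodes, which are level-2 leaves
(positive: scalar `μ`; zero-shape: complete split distribution `β_{W₁}`).  The level-2 clauses
(shapes `S₂`, regions/rôles, `C_{2,a}`, `H`, marginals, `H^max`, `P_D`, `H(μ,μ,1−2μ)`) are those of the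
`ℓ* = 2` file (`CombinationLoss2.*`), imported and reused unchanged.

Nothing is proved here: the definitions are the paper's, and Theorem 1 (case `ℓ* = 3`) is recorded
as the NAMED FACT `combinationLoss3_theorem1 : Prop` (statement only; its proof is §4–§6 of Alman et
al. 2025, not formalised).  Purpose: the typed interface against which the exact rational `ℓ* = 3`
points of the ω-construction census, family (c) (`run/shared/lean/pub/pub-omega/`, schema
`SCHEMA-c.md` v1; e.g. the certified point `l3g3_P3_cert.json`, `Ω = 2.371275973`), can later be
checked by the kernel (successor item `pub-omega-laser-g8/KERNEL-L3-ROW-SPEC.md`).  HONEST FRAMING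
(census, verbatim): lottery ticket; floor = certified bounds/negative ranges.  Every bound obtained
through this interface is CONDITIONAL on the named fact; the tree's unconditional record remains
`LeGall2014_cw4_omega_le : ω ≤ 2.37295`.

Dictionary (note §2 ↔ this file), in addition to the `ℓ* = 2` dictionary: `S₃` ↔ `shapes3`;
`Split(s)` ↔ `split3 s` and `s − u` ↔ `sub3 s u`; complete split vectors `{0,1,2}^{2^{3−1}} = {0,1,2}⁴`
↔ `ℕ × ℕ × ℕ × ℕ`, `splitVecs4`, `C_{3,a}` ↔ `csplit3 a`; concatenation of two level-2 split vectors
↔ `(L₁, L₂, L₃, L₄) = ((L₁,L₂) of T[u,r′], (L₃,L₄) of T[s−u,r′])`; the free variables ↔ the fields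
of `Point`; masses of the three node kinds ↔ `mass3`, `mass2`; β of leaves / positive nodes ↔
`leafBeta3`, `childBeta`, `nodeBetaR`, `nodeBeta`; eq. (5) ↔ `rootTerm*`, `EG`; eq. (8) ↔ `posTerm*`;
`E₃ = Σ_r min_W Σ_T E^{(r)}_{T,W}` ↔ `E3`; eq. (9) ↔ `E2`; eq. (10) ↔ `Mcoord`; (11) ↔ `Feasible`.
The transcription agrees clause by clause with the census's evaluator of record
(`pub-omega-laser/code/closs/closs.py`: `split`, `compute_masses`, `compute_betas`, `region_terms`,
`evaluate`), which four independent exact engines reproduce to ≤ 1e-12 on every certified point.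

## References

* E. Dupont et al., arXiv:2608.16884v1 (2026), §2 (pp. 2–8), eq. (1)–(11), Thm. 1. [DupontEtAl2026]
* J. Alman, R. Duan, V. Vassilevska Williams, Y. Xu, Z. Xu, R. Zhou, *More asymmetry yields faster
  matrix multiplication*, SODA 2025, arXiv:2404.16349, §7 (the optimisation problem for
  `CW_5^{⊗4}`; Table 1). [AlmanDuanVassilevskaWilliamsXuXuZhou2025]
-/

noncomputable section

open scoped BigOperators
open Finset Real

namespace Literature.Computability.AlgebraicComplexity

namespace CombinationLoss3

open CombinationLoss2

/-! ## Shapes of level 3, split sets, complete split vectors of length 4 (note §2.1–§2.2 at `ℓ* = 3`) -/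

/-- `S₃ = {(i, j, k) ∈ ℤ³_{≥0} : i + j + k = 2³ = 8}` (45 shapes), as the image of
`(i, j) ↦ (i, j, 8 − i − j)` over `i + j ≤ 8`. [cite: DupontEtAl2026, §2.1] -/
def shapes3 : Finset Shape :=
  ((range 9 ×ˢ range 9).filter (fun p => p.1 + p.2 ≤ 8)).image (fun p => (p.1, p.2, 8 - p.1 - p.2))

/-- Positive level-3 shapes (21 of them). [cite: DupontEtAl2026, §2.1] -/
def posShapes3 : Finset Shape := shapes3.filter IsPos

/-- Zero-shapes of `S₃` (24 of them): the root's leaf children. [cite: DupontEtAl2026, §2.1] -/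
def zeroShapes3 : Finset Shape := shapes3.filter (fun s => ¬ IsPos s)

/-- `Split(s) = {u ∈ S₂ : 0 ≤ u_W ≤ s_W for all W}` for a level-3 shape `s`.
[cite: DupontEtAl2026, §2.1] -/
def split3 (s : Shape) : Finset Shape :=
  shapes2.filter (fun u => u.1 ≤ s.1 ∧ u.2.1 ≤ s.2.1 ∧ u.2.2 ≤ s.2.2)

/-- `s − u`, the complementary shape of `u ∈ Split(s)`. [cite: DupontEtAl2026, §2.1] -/
def sub3 (s u : Shape) : Shape := (s.1 - u.1, s.2.1 - u.2.1, s.2.2 - u.2.2)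

/-- Level-3 complete split vectors `L = (L₁, L₂, L₃, L₄) ∈ {0,1,2}⁴` (all 81; distributions are
supported on `csplit3 a`). [cite: DupontEtAl2026, §2.2] -/
def splitVecs4 : Finset (ℕ × ℕ × ℕ × ℕ) := range 3 ×ˢ range 3 ×ˢ range 3 ×ˢ range 3

/-- `C_{3,a} = {L ∈ {0,1,2}⁴ : L₁ + L₂ + L₃ + L₄ = a}`. [cite: DupontEtAl2026, §2.2] -/
def csplit3 (a : ℕ) : Finset (ℕ × ℕ × ℕ × ℕ) :=
  splitVecs4.filter (fun L => L.1 + L.2.1 + L.2.2.1 + L.2.2.2 = a)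

/-- Number of entries of a length-4 split vector equal to `1`. [cite: DupontEtAl2026, §2.3] -/
def ones4 (L : ℕ × ℕ × ℕ × ℕ) : ℕ := ones (L.1, L.2.1) + ones L.2.2

/-- `L ↦ 2⃗ − L` on length-4 split vectors (the map `β ↦ β^∨`). [cite: DupontEtAl2026, §2.3] -/
def vee4 (L : ℕ × ℕ × ℕ × ℕ) : ℕ × ℕ × ℕ × ℕ := (2 - L.1, 2 - L.2.1, 2 - L.2.2.1, 2 - L.2.2.2)

/-! ## Free variables (note §2.2 at `ℓ* = 3`) and their domains -/

/-- A parameter point of program (11) at `ℓ* = 3`.  Root: `A_G ∈ Δ([6])`, `α_G^{(r)} ∈ Δ(S₃)`.  For a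
root child `G[s,r]`: if `s` is a zero-shape, its complete split distribution `β_{W₁} ∈ Δ(C_{3,s_{W₁}})`
(`beta3 r s`); if `s` is positive, the level-3 node `T = G[s,r]` carries `A_T ∈ Δ([6])` (`AT r s`),
`α_T^{(r′)} ∈ Δ(Split(s))` (`alphaT r s r′`), and for each child `T[u,r′]` (`u ∈ Split(s)`): the scalar
`μ ∈ [0,1/2]` if `u` is positive (`mu2 r s r′ u`), the distribution `β_{W₁} ∈ Δ(C_{2,u_{W₁}})` if `u`
is a zero-shape (`beta2 r s r′ u`).  Unused fields are ignored. [cite: DupontEtAl2026, §2.2] -/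
structure Point where
  /-- `A_G^{(r)}` -/
  A : Fin 6 → ℝ
  /-- `α_G^{(r)}(s)`, `s ∈ S₃` -/
  alpha : Fin 6 → Shape → ℝ
  /-- `β_{G[s,r], W₁}(L)` for zero-shapes `s ∈ S₃`, `L ∈ {0,1,2}⁴` -/
  beta3 : Fin 6 → Shape → (ℕ × ℕ × ℕ × ℕ) → ℝ
  /-- `A_T^{(r′)}` of the positive node `T = G[s,r]` -/
  AT : Fin 6 → Shape → Fin 6 → ℝ
  /-- `α_T^{(r′)}(u)` of the positive node `T = G[s,r]`, `u ∈ Split(s)` -/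
  alphaT : Fin 6 → Shape → Fin 6 → Shape → ℝ
  /-- `μ_{T[u,r′]}` for positive `u` -/
  mu2 : Fin 6 → Shape → Fin 6 → Shape → ℝ
  /-- `β_{T[u,r′], W₁}(L)` for zero-shapes `u`, `L ∈ {0,1,2}²` -/
  beta2 : Fin 6 → Shape → Fin 6 → Shape → (ℕ × ℕ) → ℝ

/-- The domain constraints of §2.2 at `ℓ* = 3` ("all free variables lie in the domains stated").
[cite: DupontEtAl2026, §2.2 and eq. (11)] -/
structure Point.Valid (P : Point) : Prop where
  A_nonneg : ∀ r, 0 ≤ P.A r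
  A_sum : ∑ r, P.A r = 1
  alpha_nonneg : ∀ r s, 0 ≤ P.alpha r s
  alpha_supp : ∀ r s, s ∉ shapes3 → P.alpha r s = 0
  alpha_sum : ∀ r, ∑ s ∈ shapes3, P.alpha r s = 1
  beta3_nonneg : ∀ r s L, 0 ≤ P.beta3 r s L
  beta3_supp : ∀ r s L, ¬ IsPos s → L ∉ csplit3 (coord s (firstNonzero s)) → P.beta3 r s L = 0
  beta3_sum : ∀ r s, s ∈ shapes3 → ¬ IsPos s → ∑ L ∈ csplit3 (coord s (firstNonzero s)), P.beta3 r s L = 1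
  AT_nonneg : ∀ r s r', 0 ≤ P.AT r s r'
  AT_sum : ∀ r s, s ∈ posShapes3 → ∑ r', P.AT r s r' = 1
  alphaT_nonneg : ∀ r s r' u, 0 ≤ P.alphaT r s r' u
  alphaT_supp : ∀ r s r' u, u ∉ split3 s → P.alphaT r s r' u = 0
  alphaT_sum : ∀ r s r', s ∈ posShapes3 → ∑ u ∈ split3 s, P.alphaT r s r' u = 1
  mu2_mem : ∀ r s r' u, IsPos u → 0 ≤ P.mu2 r s r' u ∧ P.mu2 r s r' u ≤ 1 / 2
  beta2_nonneg : ∀ r s r' u L, 0 ≤ P.beta2 r s r' u L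
  beta2_supp : ∀ r s r' u L, ¬ IsPos u → L ∉ csplit2 (coord u (firstNonzero u)) →
    P.beta2 r s r' u L = 0
  beta2_sum : ∀ r s r' u, s ∈ posShapes3 → u ∈ split3 s → ¬ IsPos u →
    ∑ L ∈ csplit2 (coord u (firstNonzero u)), P.beta2 r s r' u L = 1

/-! ## Masses (note §2.3, "Masses") -/

/-- Mass of the root child `G[s,r]`: `m = A_G^{(r)} α_G^{(r)}(s)`. [cite: DupontEtAl2026, §2.3 (Masses)] -/
def mass3 (P : Point) (r : Fin 6) (s : Shape) : ℝ := P.A r * P.alpha r s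

/-- Mass of the level-2 child `T[u,r′]` of the positive node `T = G[s,r]`:
`m_{T[u,r′]} = m_T · A_T^{(r′)} · (α_T^{(r′)}(u) + α_T^{(r′)}(s − u))` (the child collects the two
occurrences `u` and `s − u` of its shape pair). [cite: DupontEtAl2026, §2.3 (Masses)] -/
def mass2 (P : Point) (r : Fin 6) (s : Shape) (r' : Fin 6) (u : Shape) : ℝ :=
  mass3 P r s * P.AT r s r' * (P.alphaT r s r' u + P.alphaT r s r' (sub3 s u))

/-! ## Complete split distributions (note §2.3, eq. (2) and the recursive clause for positive nodes) -/

/-- The complete split distribution `β_{T[u,r′], c}` (length 2) of a level-2 child of the positive node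
`T = G[s,r]`: eq. (2) for positive `u`, and `δ_{0⃗}` / the free `β_{W₁}` / `β^∨` for a zero-shape
`u` — the clause `CombinationLoss2.leafBeta` with the child's `μ`, `β`. [cite: DupontEtAl2026, §2.3 eq. (2)] -/
def childBeta (P : Point) (r : Fin 6) (s : Shape) (r' : Fin 6) (u : Shape) (c : Fin 3)
    (L : ℕ × ℕ) : ℝ :=
  if IsPos u then
    (if coord u c = 2 then
      (if L = (0, 2) ∨ L = (2, 0) then P.mu2 r s r' u
        else if L = (1, 1) then 1 - 2 * P.mu2 r s r' u else 0)
    else (if L = (0, 1) ∨ L = (1, 0) then 1 / 2 else 0))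
  else
    (if c = firstZero u then (if L = (0, 0) then 1 else 0)
    else if c = firstNonzero u then P.beta2 r s r' u L
    else (if L ∈ splitVecs then P.beta2 r s r' u (vee L) else 0))

/-- The complete split distribution `β_{G[s,r], c}` (length 4) of a zero-shape root child: `δ_{0⃗}` on
the first zero coordinate `W₀`, the free `β_{W₁}` on the first non-zero coordinate, `β_{W₁}^∨` on the
remaining one. [cite: DupontEtAl2026, §2.3 eq. (2)] -/
def leafBeta3 (P : Point) (r : Fin 6) (s : Shape) (c : Fin 3) (L : ℕ × ℕ × ℕ × ℕ) : ℝ :=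
  if c = firstZero s then (if L = (0, 0, 0, 0) then 1 else 0)
  else if c = firstNonzero s then P.beta3 r s L
  else (if L ∈ splitVecs4 then P.beta3 r s (vee4 L) else 0)

/-- The region-`r′` complete split distribution of the positive node `T = G[s,r]` in coordinate `c`:
`β^{(r′)}_{T,c} = Σ_{u ∈ Split(s)} α_T^{(r′)}(u) · (β_{T[u,r′],c} ⊗ β_{T[s−u,r′],c})`, the concatenation
product placing `T[u,r′]`'s length-2 vector in positions 1–2 and `T[s−u,r′]`'s in positions 3–4.
[cite: DupontEtAl2026, §2.3 (complete split distributions of positive-shape nodes)] -/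
def nodeBetaR (P : Point) (r : Fin 6) (s : Shape) (r' : Fin 6) (c : Fin 3)
    (L : ℕ × ℕ × ℕ × ℕ) : ℝ :=
  ∑ u ∈ split3 s, P.alphaT r s r' u *
    (childBeta P r s r' u c (L.1, L.2.1) * childBeta P r s r' (sub3 s u) c L.2.2)

/-- `β_{T,c} = Σ_{r′} A_T^{(r′)} β^{(r′)}_{T,c}` for the positive node `T = G[s,r]`.
[cite: DupontEtAl2026, §2.3 (complete split distributions of positive-shape nodes)] -/
def nodeBeta (P : Point) (r : Fin 6) (s : Shape) (c : Fin 3) (L : ℕ × ℕ × ℕ × ℕ) : ℝ :=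
  ∑ r', P.AT r s r' * nodeBetaR P r s r' c L

/-- The complete split distribution `β_{G[s,r], c}` of ANY root child (leaf or positive node), as used by
the root's retained exponent (eqs. (3)–(5)). [cite: DupontEtAl2026, §2.3] -/
def rootChildBeta (P : Point) (r : Fin 6) (s : Shape) (c : Fin 3) (L : ℕ × ℕ × ℕ × ℕ) : ℝ :=
  if IsPos s then nodeBeta P r s c L else leafBeta3 P r s c L

/-! ## The root's retained exponent `E_G` (eqs. (3)–(5) with `S₃` and length-4 split vectors) -/

/-- Entropy of the `c`-marginal of a distribution on level-3 shapes (values `0..8`).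
[cite: DupontEtAl2026, §2.3] -/
def Hmarg3 (D : Finset Shape) (ρ : Shape → ℝ) (c : Fin 3) : ℝ := Hb (range 9) (marg D ρ c)

/-- `η^{(r)}_{G,Y}` (eq. (3), rôles relabelled by region `r`): shapes with `s_Z = 0` contribute
`α(s) H(β_{G[s,r],Y})`, the others are grouped by `j = s_Y` and contribute `α(*,j,+) H(β̄_{Y,*,j,+})`.
[cite: DupontEtAl2026, §2.3 eq. (3)] -/
def rootEtaY (P : Point) (r : Fin 6) : ℝ :=
  let cy := role r 1
  let cz := role r 2
  let α := P.alpha r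
  (∑ s ∈ shapes3.filter (fun s => coord s cz = 0), α s * Hb splitVecs4 (rootChildBeta P r s cy)) +
  ∑ j ∈ range 9,
    (let G := shapes3.filter (fun s => coord s cy = j ∧ 0 < coord s cz)
     let W := ∑ s ∈ G, α s
     if W = 0 then 0
     else W * Hb splitVecs4 (fun L => (∑ s ∈ G, α s * rootChildBeta P r s cy L) / W))

/-- `η^{(r)}_{G,Z}` (eq. (4)): shapes with `s_X = 0` or `s_Y = 0` contribute `α(s) H(β_{G[s,r],Z})`, the
others are grouped by `k = s_Z`. [cite: DupontEtAl2026, §2.3 eq. (4)] -/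
def rootEtaZ (P : Point) (r : Fin 6) : ℝ :=
  let cx := role r 0
  let cy := role r 1
  let cz := role r 2
  let α := P.alpha r
  (∑ s ∈ shapes3.filter (fun s => coord s cx = 0 ∨ coord s cy = 0),
      α s * Hb splitVecs4 (rootChildBeta P r s cz)) +
  ∑ k ∈ range 9,
    (let G := shapes3.filter (fun s => 0 < coord s cx ∧ 0 < coord s cy ∧ coord s cz = k)
     let W := ∑ s ∈ G, α s
     if W = 0 then 0
     else W * Hb splitVecs4 (fun L => (∑ s ∈ G, α s * rootChildBeta P r s cz L) / W))

/-- `β̄^{(r)}_{G,c} = Σ_s α^{(r)}(s) β_{G[s,r],c}`. [cite: DupontEtAl2026, §2.3 eq. (5)] -/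
def rootBetaBar (P : Point) (r : Fin 6) (c : Fin 3) (L : ℕ × ℕ × ℕ × ℕ) : ℝ :=
  ∑ s ∈ shapes3, P.alpha r s * rootChildBeta P r s c L

/-- The `X`-rôle term of eq. (5): `H((α^{(r)})_X) − P_{S₃}(α^{(r)})`. [cite: DupontEtAl2026, §2.3 eq. (5)] -/
def rootTermX (P : Point) (r : Fin 6) : ℝ :=
  Hmarg3 shapes3 (P.alpha r) (role r 0) - penalty shapes3 (P.alpha r)

/-- The `Y`-rôle term of eq. (5): `H(β̄_Y) − η_Y`. [cite: DupontEtAl2026, §2.3 eq. (5)] -/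
def rootTermY (P : Point) (r : Fin 6) : ℝ := Hb splitVecs4 (rootBetaBar P r (role r 1)) - rootEtaY P r

/-- The `Z`-rôle term of eq. (5): `H(β̄_Z) − η_Z`. [cite: DupontEtAl2026, §2.3 eq. (5)] -/
def rootTermZ (P : Point) (r : Fin 6) : ℝ := Hb splitVecs4 (rootBetaBar P r (role r 2)) - rootEtaZ P r

/-- `E_G = Σ_r A_G^{(r)} min(X, Y, Z rôle terms)`. [cite: DupontEtAl2026, §2.3 eq. (5)] -/
def EG (P : Point) : ℝ := ∑ r, P.A r * min (rootTermX P r) (min (rootTermY P r) (rootTermZ P r))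

/-! ## The level-3 positive nodes' retained exponents (eqs. (6)–(8)) and `E₃` -/

/-- The weight of the child `T[u,r′]` in the `η`-mixtures of a positive node of shape `s`:
`α_T^{(r′)}(u) + α_T^{(r′)}(s − u)`. [cite: DupontEtAl2026, §2.3 eqs. (6)–(7)] -/
def childW (P : Point) (r : Fin 6) (s : Shape) (r' : Fin 6) (u : Shape) : ℝ :=
  P.alphaT r s r' u + P.alphaT r s r' (sub3 s u)

/-- `η^{(r′)}_{T,Y}` of the positive node `T = G[s,r]` (eq. (6)): over `u ∈ Split(s)`, the `u` with
`u_Z = 0` contribute `w(u) H(β_{T[u,r′],Y})`, the others are grouped by `j = u_Y` and contribute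
`W_j H(mixture_j)`. [cite: DupontEtAl2026, §2.3 eq. (6)] -/
def posEtaY (P : Point) (r : Fin 6) (s : Shape) (r' : Fin 6) : ℝ :=
  let cy := role r' 1
  let cz := role r' 2
  (∑ u ∈ (split3 s).filter (fun u => coord u cz = 0),
      childW P r s r' u * Hb splitVecs (childBeta P r s r' u cy)) +
  ∑ j ∈ range 5,
    (let G := (split3 s).filter (fun u => coord u cy = j ∧ 0 < coord u cz)
     let W := ∑ u ∈ G, childW P r s r' u
     if W = 0 then 0
     else W * Hb splitVecs (fun L => (∑ u ∈ G, childW P r s r' u * childBeta P r s r' u cy L) / W))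

/-- `η^{(r′)}_{T,Z}` of the positive node `T = G[s,r]` (eq. (7)). [cite: DupontEtAl2026, §2.3 eq. (7)] -/
def posEtaZ (P : Point) (r : Fin 6) (s : Shape) (r' : Fin 6) : ℝ :=
  let cx := role r' 0
  let cy := role r' 1
  let cz := role r' 2
  (∑ u ∈ (split3 s).filter (fun u => coord u cx = 0 ∨ coord u cy = 0),
      childW P r s r' u * Hb splitVecs (childBeta P r s r' u cz)) +
  ∑ k ∈ range 5,
    (let G := (split3 s).filter (fun u => 0 < coord u cx ∧ 0 < coord u cy ∧ coord u cz = k)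
     let W := ∑ u ∈ G, childW P r s r' u
     if W = 0 then 0
     else W * Hb splitVecs (fun L => (∑ u ∈ G, childW P r s r' u * childBeta P r s r' u cz L) / W))

/-- The `X`-rôle factor of eq. (8) for `T = G[s,r]` in region `r′`:
`H((α_T^{(r′)})_X) − P_{Split(s)}(α_T^{(r′)})`. [cite: DupontEtAl2026, §2.3 eq. (8)] -/
def posTermX (P : Point) (r : Fin 6) (s : Shape) (r' : Fin 6) : ℝ :=
  Hmarg (split3 s) (P.alphaT r s r') (role r' 0) - penalty (split3 s) (P.alphaT r s r')

/-- The `Y`-rôle factor of eq. (8): `H(β^{(r′)}_{T,Y}) − η^{(r′)}_{T,Y}`. [cite: DupontEtAl2026, §2.3 eq. (8)] -/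
def posTermY (P : Point) (r : Fin 6) (s : Shape) (r' : Fin 6) : ℝ :=
  Hb splitVecs4 (nodeBetaR P r s r' (role r' 1)) - posEtaY P r s r'

/-- The `Z`-rôle factor of eq. (8): `H(β^{(r′)}_{T,Z}) − η^{(r′)}_{T,Z}`. [cite: DupontEtAl2026, §2.3 eq. (8)] -/
def posTermZ (P : Point) (r : Fin 6) (s : Shape) (r' : Fin 6) : ℝ :=
  Hb splitVecs4 (nodeBetaR P r s r' (role r' 2)) - posEtaZ P r s r'

/-- The rôle factor of eq. (8) that lands on the ABSOLUTE coordinate `c` in region `r′`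
(`c = π_{r′}(X)`, `π_{r′}(Y)` or `π_{r′}(Z)`). [cite: DupontEtAl2026, §2.3 eq. (8)] -/
def posTermAt (P : Point) (r : Fin 6) (s : Shape) (r' : Fin 6) (c : Fin 3) : ℝ :=
  if role r' 0 = c then posTermX P r s r'
  else if role r' 1 = c then posTermY P r s r' else posTermZ P r s r'

/-- `Σ_T E^{(r′)}_{T,c}` over the level-3 positive nodes: `E^{(r′)}_{T,c} = m_T A_T^{(r′)} · (factor on c)`.
[cite: DupontEtAl2026, §2.3 eq. (8) and §2.4 (definition of E_ℓ)] -/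
def E3coord (P : Point) (r' : Fin 6) (c : Fin 3) : ℝ :=
  ∑ r, ∑ s ∈ posShapes3, mass3 P r s * P.AT r s r' * posTermAt P r s r' c

/-- `E₃ = Σ_{r′} min_c Σ_T E^{(r′)}_{T,c}`. [cite: DupontEtAl2026, §2.4 (definition of E_ℓ, ℓ = 3)] -/
def E3 (P : Point) : ℝ := ∑ r', min (E3coord P r' 0) (min (E3coord P r' 1) (E3coord P r' 2))

/-! ## Level-2 exponents `E₂` (eq. (9)) and local matrix sizes (eq. (10)) over the leaves -/

/-- `Σ_{T ∈ T⁺₂} E_{T,c}` over the positive level-2 leaves `T[u,r′]`: `m · (1, 1, H(μ,μ,1−2μ))` with the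
`H` on the coordinate where `u` has the entry `2`. [cite: DupontEtAl2026, §2.3 eq. (9)] -/
def E2coord (P : Point) (c : Fin 3) : ℝ :=
  ∑ r, ∑ s ∈ posShapes3, ∑ r', ∑ u ∈ (split3 s).filter IsPos,
    mass2 P r s r' u * (if coord u c = 2 then h3 (P.mu2 r s r' u) else 1)

/-- `E₂ = min_c Σ_T E_{T,c}`. [cite: DupontEtAl2026, §2.3 eq. (9)] -/
def E2 (P : Point) : ℝ := min (E2coord P 0) (min (E2coord P 1) (E2coord P 2))

/-- `Σ_{leaves} M_{T,c}` (eq. (10)): positive level-2 leaves contribute `m (1−2μ) log₂ q` on the two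
coordinates with entry `1` and `m · 2μ log₂ q` on the coordinate with entry `2`; a zero-shape leaf (at
level 2 under a positive node, or at level 3 under the root) contributes
`m (H(β_{W₁}) + Σ_L β_{W₁}(L) |{p : L_p = 1}| log₂ q)` on its first zero coordinate `W₀` and `0`
elsewhere. [cite: DupontEtAl2026, §2.3 eq. (10)] -/
def Mcoord (q : ℕ) (P : Point) (c : Fin 3) : ℝ :=
  (∑ r, ∑ s ∈ posShapes3, ∑ r',
    ((∑ u ∈ (split3 s).filter IsPos, mass2 P r s r' u *
        (if coord u c = 2 then 2 * P.mu2 r s r' u else 1 - 2 * P.mu2 r s r' u) * Real.logb 2 q) +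
     (∑ u ∈ (split3 s).filter (fun u => ¬ IsPos u), if firstZero u = c then
        mass2 P r s r' u * (Hb splitVecs (P.beta2 r s r' u) +
          (∑ L ∈ splitVecs, P.beta2 r s r' u L * (ones L : ℝ)) * Real.logb 2 q) else 0))) +
  (∑ r, ∑ s ∈ zeroShapes3, if firstZero s = c then
      mass3 P r s * (Hb splitVecs4 (P.beta3 r s) +
        (∑ L ∈ splitVecs4, P.beta3 r s L * (ones4 L : ℝ)) * Real.logb 2 q) else 0)

/-- `M_total = min_c Σ_{leaves} M_{T,c}`. [cite: DupontEtAl2026, §2.4] -/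
def Mtotal (q : ℕ) (P : Point) : ℝ := min (Mcoord q P 0) (min (Mcoord q P 1) (Mcoord q P 2))

/-! ## Program (11) at `ℓ* = 3` and Theorem 1 -/

/-- `E_total = E_G + E₂ + E₃`. [cite: DupontEtAl2026, §2.4] -/
def Etotal (P : Point) : ℝ := EG P + E2 P + E3 P

/-- Feasibility of `(P, Ω)` for program (11) at `(q, ℓ* = 3)`:
`E_total + M_total · Ω ≥ 2^{ℓ*−1} log₂(q+2) = 4 log₂(q+2)`. [cite: DupontEtAl2026, §2.4 eq. (11)] -/
def Feasible (q : ℕ) (P : Point) (Ω : ℝ) : Prop :=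
  4 * Real.logb 2 (q + 2) ≤ Etotal P + Mtotal q P * Ω

/-- `S₃` is exactly the set of triples of naturals summing to `2³ = 8`. [cite: DupontEtAl2026, §2.1] -/
theorem mem_shapes3_iff (i j k : ℕ) : (i, j, k) ∈ shapes3 ↔ i + j + k = 8 := by
  simp only [shapes3, Finset.mem_image, Finset.mem_filter, Finset.mem_product, Finset.mem_range,
    Prod.exists, Prod.mk.injEq]
  constructor
  · rintro ⟨a, b, ⟨⟨-, -⟩, hab⟩, rfl, rfl, rfl⟩
    omega
  · intro h
    exact ⟨i, j, ⟨⟨by omega, by omega⟩, by omega⟩, rfl, rfl, by omega⟩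

/-- `S₃` has 45 shapes, 21 positive and 24 zero-shapes (the root has `6 · 45 = 270` children, of which
`126` are positive nodes). [cite: DupontEtAl2026, §2.1] -/
theorem card_shapes3 : shapes3.card = 45 ∧ posShapes3.card = 21 ∧ zeroShapes3.card = 24 := by
  refine ⟨by decide, by decide, by decide⟩

/-- Example: `Split((6,1,1)) = {(4,0,0), (3,1,0), (3,0,1), (2,1,1)}`. [cite: DupontEtAl2026, §2.1] -/
theorem split3_611 : split3 (6, 1, 1) = {(2, 1, 1), (3, 0, 1), (3, 1, 0), (4, 0, 0)} := by decide

end CombinationLoss3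

/-- **Theorem 1 of Dupont et al. 2026 (= Alman–Duan–Vassilevska Williams–Xu–Xu–Zhou 2025), case
`ℓ* = 3`:** for every integer `q ≥ 1`, every parameter point in the stated domains that is feasible for
program (11) at `ℓ* = 3` with objective `Ω` certifies `ω ≤ Ω` (over `ℂ`).  Named fact (statement
only; the proof is the combination-loss laser method on `CW_q^{⊗4}`, Alman et al. 2025 §4–§6, not
formalised; see the file docstring for the honest framing).
[cite: DupontEtAl2026, §2.4 Thm. 1 and eq. (11); AlmanDuanVassilevskaWilliamsXuXuZhou2025, §7] -/
def combinationLoss3_theorem1 : Prop :=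
  ∀ (q : ℕ), 1 ≤ q → ∀ (P : CombinationLoss3.Point) (Ω : ℝ),
    P.Valid → CombinationLoss3.Feasible q P Ω → omega ℂ ≤ Ω

end Literature.Computability.AlgebraicComplexity
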